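import Summits.FinalStateConjecture.FinalStateConjecture.Theses.PhotonSphereChannels
import Literature.Geometry.Lorentzian.MinkowskiGlobalHyperbolicity
import Literature.Geometry.Lorentzian.MinkowskiCauchy
import Literature.Geometry.Lorentzian.MinkowskiCauchyDevelopment
import Literature.Geometry.Lorentzian.CauchyProblemProofs

/-!
# Null terminality needs UNIFORM contraction — part 1/3: the profile, the region `W ⊆ D⁺`, the null line
(negative-side result for crux `TameCensorship`, `stmt-FinalStateConjecture-10047`, line
`crush-the-swallowed-interior`, registered stub `stub_nullTerminality`; cdisprove seat, cycle 3;
see part 3/3 `NullTerminalityNeedsUniformity.lean` for the statement and the summary)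

* `not_bddBelow_time_of_isFutureCausalCurveOn` — along a past-ENDLESS causal curve of Minkowski spacetime
  the time coordinate is unbounded below (causal twin of the tree's timelike `Minkowski.not_bddBelow_time`);
* the profile `uprof r = −log(1 + eʳ)`, strictly decreasing, negative, with `u' = uderiv ∈ (−1, 0)`,
  `u'' = uderiv2 < 0`, strictly `1`-Lipschitz (`abs_uprof_sub_lt`); the factor `cfac = (1 − u'²)^{−1/2}`;
* `regionW_subset_fdod_graph` — every point of `W = {u(x¹) ≤ x⁰, x⁰ + x¹ < 0}` lies in the FAITHFUL future
  domain of dependence of the graph `{x⁰ = u(x¹)}` (unit speed + `t → −∞` + intermediate value theorem);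
* the null line `nullLine q₀ t = q₀ + t (e₀ − e₁)`: a geodesic of the flat Levi-Civita connection
  (`isGeodesic_nullLine`, from `ModelSpace.isGeodesic_line`), with `x⁰ + x¹` constant, in `W` for `t ≥ −q₀⁰`.
-/

noncomputable section

open Bundle Set Filter Function Topology
open scoped Manifold ContDiff InnerProductSpace

namespace Summit.FinalStateConjecture.FinalStateConjecture.Theorems.TameCensorship.Negative

open Literature.Geometry.Lorentzian

local notation "η₄" => (LorentzianMetric.ofLE (n' := (∞ : ℕ∞ω)) Minkowski.metric le_top)
local notation "∂ₜ" => (TimeOrientation.ofLE (n' := (∞ : ℕ∞ω)) Minkowski.timeOrientation le_top)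

/-! ## S1 Past-endless causal curves of Minkowski spacetime have time unbounded below -/

/-- A past endless CAUSAL curve of Minkowski spacetime, defined on an interval, has time coordinate
unbounded below (causal version of the tree's `Minkowski.not_bddBelow_time`). -/
theorem not_bddBelow_time_of_isFutureCausalCurveOn {γ : ℝ → E4} {s : Set ℝ} (hs : s.OrdConnected)
    (h : LorentzianMetric.IsFutureCausalCurveOn η₄ ∂ₜ γ s)
    (hend : IsPastEndless γ s) : ¬ BddBelow ((fun σ ↦ γ σ 0) '' s) := by
  intro hb
  haveI : Nonempty s := hend.nonempty.to_subtype
  have hmono : Monotone fun σ : sᵒᵈ ↦ -γ (OrderDual.ofDual σ).1 0 := by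
    intro i j hij
    have := (Minkowski.strictMonoOn_time_of_isFutureCausalCurveOn hs h).monotoneOn
      (OrderDual.ofDual j).2 (OrderDual.ofDual i).2 (OrderDual.ofDual_le_ofDual.mpr hij)
    simpa using this
  have hb' : BddAbove (range fun σ : sᵒᵈ ↦ -γ (OrderDual.ofDual σ).1 0) := by
    obtain ⟨m, hm⟩ := hb
    refine ⟨-m, ?_⟩
    rintro _ ⟨σ, rfl⟩
    have := hm ⟨(OrderDual.ofDual σ).1, (OrderDual.ofDual σ).2, rfl⟩
    simpa using this
  obtain ⟨⟨T, hT⟩, q, hq⟩ := Minkowski.tendsto_of_monotone_of_dist_le hmono hb'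
    (x := fun σ : sᵒᵈ ↦ E4.spatial (γ (OrderDual.ofDual σ).1))
    (fun i j hij ↦ by
      rw [dist_comm, dist_eq_norm]
      have := Minkowski.norm_spatial_sub_le_of_isFutureCausalCurveOn hs h (OrderDual.ofDual j).2
        (OrderDual.ofDual i).2 (OrderDual.ofDual_le_ofDual.mpr hij)
      linarith)
  have hT' : Tendsto (fun σ : sᵒᵈ ↦ γ (OrderDual.ofDual σ).1 0) atTop (𝓝 (-T)) := by
    simpa using hT.neg
  have hlim := Minkowski.tendsto_of_tendsto_time_spatial hT' hq
  exact hend.2 _ hlim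

/-! ## S2 The profile `u(r) = −log(1 + eʳ)` and the region `W = {u(x¹) ≤ t, t + x¹ < 0}` -/

/-- The profile `u(r) = −log(1 + eʳ)` (minus softplus). -/
def uprof (r : ℝ) : ℝ := -Real.log (1 + Real.exp r)

/-- `1 + eʳ > 0`. -/
theorem one_add_exp_pos (r : ℝ) : 0 < 1 + Real.exp r := by positivity

/-- `u < 0` everywhere. -/
theorem uprof_neg (r : ℝ) : uprof r < 0 := by
  unfold uprof
  have : 0 < Real.log (1 + Real.exp r) := Real.log_pos (by linarith [Real.exp_pos r])
  linarith

/-- `u` is strictly decreasing. -/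
theorem uprof_strictAnti : StrictAnti uprof := by
  intro a b hab
  unfold uprof
  have ha := one_add_exp_pos a
  have h : Real.log (1 + Real.exp a) < Real.log (1 + Real.exp b) :=
    Real.log_lt_log ha (by linarith [Real.exp_lt_exp.mpr hab])
  linarith

/-- Key estimate: `r + u(A − r)`… in the form used below: for `A < 0` and every real `τ`,
`τ − u(A − τ) = A + log(1 + e^{τ − A})`. -/
theorem sub_uprof_eq (A τ : ℝ) : τ - uprof (A - τ) = A + Real.log (1 + Real.exp (τ - A)) := by
  unfold uprof
  have h1 : 1 + Real.exp (A - τ) = Real.exp (A - τ) * (1 + Real.exp (τ - A)) := by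
    rw [mul_add, mul_one, ← Real.exp_add, show A - τ + (τ - A) = 0 by ring, Real.exp_zero]
    ring
  rw [h1, Real.log_mul (Real.exp_pos _).ne' (one_add_exp_pos _).ne', Real.log_exp]
  ring

/-- For `A < 0` there is a threshold `τ₀` below which `τ − u(A − τ) < 0`. -/
theorem exists_sub_uprof_neg {A : ℝ} (hA : A < 0) : ∃ τ₀ : ℝ, ∀ τ ≤ τ₀, τ - uprof (A - τ) < 0 := by
  -- need log(1 + e^{τ−A}) < −A, i.e. e^{τ−A} < e^{−A} − 1 (> 0)
  have hpos : 0 < Real.exp (-A) - 1 := by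
    have : 1 < Real.exp (-A) := Real.one_lt_exp_iff.mpr (by linarith)
    linarith
  refine ⟨A + Real.log ((Real.exp (-A) - 1) / 2), fun τ hτ ↦ ?_⟩
  rw [sub_uprof_eq]
  have h1 : Real.exp (τ - A) ≤ (Real.exp (-A) - 1) / 2 := by
    have : τ - A ≤ Real.log ((Real.exp (-A) - 1) / 2) := by linarith
    calc Real.exp (τ - A) ≤ Real.exp (Real.log ((Real.exp (-A) - 1) / 2)) := Real.exp_le_exp.mpr this
      _ = (Real.exp (-A) - 1) / 2 := Real.exp_log (by positivity)
  have h2 : 1 + Real.exp (τ - A) < Real.exp (-A) := by linarith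
  have h3 : Real.log (1 + Real.exp (τ - A)) < -A := by
    have := Real.log_lt_log (one_add_exp_pos _) h2
    rwa [Real.log_exp] at this
  linarith

/-- The graph `S″ = {x | x⁰ = u(x¹)}` of the profile over the spatial slices. -/
def graphSet : Set E4 := {x | x 0 = uprof (x 1)}

/-- The region `W = {u(x¹) ≤ x⁰, x⁰ + x¹ < 0}` (it will turn out to lie in `D⁺(S″)`). -/
def regionW : Set E4 := {x | uprof (x 1) ≤ x 0 ∧ x 0 + x 1 < 0}

/-- A coordinate of a vector of `E3` is bounded by its norm. -/
theorem abs_apply_le_norm_E3 (v : E3) (i : Fin 3) : |v i| ≤ ‖v‖ := by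
  rw [EuclideanSpace.norm_eq]
  apply Real.abs_le_sqrt
  have := Finset.single_le_sum (f := fun j : Fin 3 ↦ ‖v j‖ ^ 2) (fun j _ ↦ sq_nonneg _)
    (Finset.mem_univ i)
  simpa [Real.norm_eq_abs, sq_abs] using this

/-- `x¹` of a point of `E4` is the `0`-th spatial coordinate. -/
theorem spatial_apply_zero (x : E4) : E4.spatial x 0 = x 1 := by
  simp [E4.spatial]

/-- `u` is continuous. -/
theorem continuous_uprof : Continuous uprof := by
  unfold uprof
  exact ((continuous_const.add Real.continuous_exp).log fun r ↦ (one_add_exp_pos r).ne').neg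

/-- **Every point of `W` lies in the FAITHFUL future domain of dependence of the graph**: a past
endless causal curve through `p ∈ W` has time `→ −∞`, moves at most at unit speed, hence drifts
in `x¹` by at most the elapsed time; since `u` decreases, `t − u(x¹) ≤ t − u(A − t)` with
`A = p⁰ + p¹ < 0`, which is negative for `t` small enough (`exists_sub_uprof_neg`); by the
intermediate value theorem `t − u(x¹)` vanishes somewhere at or before `p`. -/
theorem regionW_subset_fdod_graph {p : E4} (hp : p ∈ regionW)
    (β : ℝ → E4) (s : Set ℝ) (hs : s.OrdConnected)
    (hβ : LorentzianMetric.IsFutureCausalCurveOn η₄ ∂ₜ β s) (hend : IsPastEndless β s)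
    {t₀ : ℝ} (ht₀ : t₀ ∈ s) (hβp : β t₀ = p) :
    ∃ t ∈ s, t ≤ t₀ ∧ β t ∈ graphSet := by
  obtain ⟨hpu, hpA⟩ := hp
  set A : ℝ := p 0 + p 1 with hA
  set φ : ℝ → ℝ := fun σ ↦ β σ 0 - uprof (β σ 1) with hφ
  -- continuity of φ on s
  have hφcont : ContinuousOn φ s := by
    intro σ hσ
    have hc : ContinuousAt β σ := (hβ σ hσ).1.continuousAt
    have h0 : ContinuousAt (fun σ ↦ β σ 0) σ :=
      ((EuclideanSpace.proj (0 : Fin 4) : E4 →L[ℝ] ℝ).continuous.continuousAt).comp hc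
    have h1 : ContinuousAt (fun σ ↦ β σ 1) σ :=
      ((EuclideanSpace.proj (1 : Fin 4) : E4 →L[ℝ] ℝ).continuous.continuousAt).comp hc
    exact (h0.sub (continuous_uprof.continuousAt.comp h1)).continuousWithinAt
  -- threshold
  obtain ⟨τ₀, hτ₀⟩ := exists_sub_uprof_neg hpA
  -- time unbounded below: a parameter σ₁ ∈ s with small time
  have hnb := not_bddBelow_time_of_isFutureCausalCurveOn hs hβ hend
  obtain ⟨σ₁, hσ₁s, hσ₁t⟩ : ∃ σ₁ ∈ s, β σ₁ 0 < min τ₀ (p 0) := by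
    by_contra hcon
    push Not at hcon
    exact hnb ⟨min τ₀ (p 0), by rintro _ ⟨σ, hσ, rfl⟩; exact hcon σ hσ⟩
  have hσ₁τ : β σ₁ 0 ≤ τ₀ := (hσ₁t.trans_le (min_le_left _ _)).le
  have hσ₁p : β σ₁ 0 < p 0 := hσ₁t.trans_le (min_le_right _ _)
  -- σ₁ < t₀ by strict monotonicity of time
  have hmono := Minkowski.strictMonoOn_time_of_isFutureCausalCurveOn hs hβ
  have hσ₁lt : σ₁ < t₀ := by
    by_contra hle
    push Not at hle
    have := hmono.monotoneOn ht₀ hσ₁s hle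
    simp only at this
    rw [hβp] at this
    linarith
  -- spatial drift bound
  have hdrift : β σ₁ 1 ≤ A - β σ₁ 0 := by
    have h1 := Minkowski.norm_spatial_sub_le_of_isFutureCausalCurveOn hs hβ hσ₁s ht₀ hσ₁lt.le
    rw [hβp] at h1
    have h2 : |(E4.spatial p - E4.spatial (β σ₁)) 0| ≤ ‖E4.spatial p - E4.spatial (β σ₁)‖ :=
      abs_apply_le_norm_E3 _ 0
    have h3 : (E4.spatial p - E4.spatial (β σ₁)) 0 = p 1 - β σ₁ 1 := by
      simp [E4.spatial]
    rw [h3] at h2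
    have h4 : -(p 1 - β σ₁ 1) ≤ |p 1 - β σ₁ 1| := neg_le_abs _
    rw [hA]
    linarith
  -- φ σ₁ < 0
  have hφσ₁ : φ σ₁ < 0 := by
    have hu : uprof (A - β σ₁ 0) ≤ uprof (β σ₁ 1) := uprof_strictAnti.antitone hdrift
    have := hτ₀ (β σ₁ 0) hσ₁τ
    simp only [hφ]
    linarith
  -- φ t₀ ≥ 0
  have hφt₀ : 0 ≤ φ t₀ := by
    simp only [hφ, hβp]
    linarith
  -- IVT on [σ₁, t₀]
  have hsub : Icc σ₁ t₀ ⊆ s := hs.out hσ₁s ht₀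
  obtain ⟨t, ht, hφt⟩ := intermediate_value_Icc hσ₁lt.le (hφcont.mono hsub) ⟨hφσ₁.le, hφt₀⟩
  refine ⟨t, hsub ht, ht.2, ?_⟩
  show β t 0 = uprof (β t 1)
  have : φ t = 0 := hφt
  simp only [hφ] at this
  linarith

/-! ## S3 The null line `ℓ(σ) = q₀ + σ (e₀ − e₁)` -/

/-- The null direction `e₀ − e₁`. -/
def nullDir : E4 := E4.basisVector 0 - E4.basisVector 1

/-- Time component of the null direction. -/
@[simp] theorem nullDir_apply_zero : nullDir 0 = 1 := by simp [nullDir]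
/-- `x¹`-component of the null direction. -/
@[simp] theorem nullDir_apply_one : nullDir 1 = -1 := by simp [nullDir]
/-- `x²`-component of the null direction. -/
@[simp] theorem nullDir_apply_two : nullDir 2 = 0 := by simp [nullDir, Fin.ext_iff]
/-- `x³`-component of the null direction. -/
@[simp] theorem nullDir_apply_three : nullDir 3 = 0 := by simp [nullDir, Fin.ext_iff]

/-- `η(e₀ − e₁, e₀ − e₁) = 0`: the direction is null. -/
theorem bilin_nullDir_nullDir : Minkowski.bilin nullDir nullDir = 0 := by
  simp [Minkowski.bilin_apply, Fin.sum_univ_three, Fin.succ_zero_eq_one, Fin.succ_one_eq_two]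

/-- The null line through `q₀`. -/
def nullLine (q₀ : E4) (σ : ℝ) : E4 := q₀ + σ • nullDir

/-- Along the null line, `x⁰ + x¹` is constant. -/
theorem nullLine_sum (q₀ : E4) (σ : ℝ) : nullLine q₀ σ 0 + nullLine q₀ σ 1 = q₀ 0 + q₀ 1 := by
  simp [nullLine]
  ring

/-- The null line is eventually in `W` if `q₀⁰ + q₀¹ < 0`: for `σ ≥ −q₀⁰`. -/
theorem nullLine_mem_regionW {q₀ : E4} (hq : q₀ 0 + q₀ 1 < 0) {σ : ℝ} (hσ : -q₀ 0 ≤ σ) :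
    nullLine q₀ σ ∈ regionW := by
  refine ⟨?_, by rw [nullLine_sum]; exact hq⟩
  have h0 : nullLine q₀ σ 0 = q₀ 0 + σ := by simp [nullLine]
  rw [h0]
  linarith [uprof_neg (nullLine q₀ σ 1)]

/-- The null line is a geodesic of the Levi-Civita connection of Minkowski spacetime, with velocity
`nullDir`. -/
theorem isGeodesic_nullLine [Minkowski.smoothMetric.toPseudoRiemannianMetric.HasLeviCivita] (q₀ : E4) :
    IsGeodesic Minkowski.smoothMetric.toPseudoRiemannianMetric.leviCivita (nullLine q₀) :=
  ModelSpace.isGeodesic_line (g := Minkowski.smoothMetric.toPseudoRiemannianMetric)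
    (G₀ := Minkowski.bilin) Minkowski.smoothMetric_val q₀ nullDir

/-- The velocity of the null line is the constant null direction. -/
theorem velocity_nullLine (q₀ : E4) (σ : ℝ) : velocity 𝓘(ℝ, E4) (nullLine q₀) σ = nullDir :=
  ModelSpace.velocity_line q₀ nullDir σ


/-! ## S4 Calculus of the profile: `u' = −eʳ/(1+eʳ) ∈ (−1, 0)`, `u'' = −eʳ/(1+eʳ)² < 0` -/

/-- `u'(r) = −eʳ/(1 + eʳ)`. -/
def uderiv (r : ℝ) : ℝ := -(Real.exp r / (1 + Real.exp r))

/-- `u''(r) = −eʳ/(1 + eʳ)²`. -/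
def uderiv2 (r : ℝ) : ℝ := -(Real.exp r / (1 + Real.exp r) ^ 2)

/-- `u' = uderiv`. -/
theorem hasDerivAt_uprof (r : ℝ) : HasDerivAt uprof (uderiv r) r := by
  unfold uprof uderiv
  have h1 : HasDerivAt (fun r ↦ 1 + Real.exp r) (Real.exp r) r := by
    simpa using (Real.hasDerivAt_exp r).const_add 1
  have h2 := h1.log (one_add_exp_pos r).ne'
  exact h2.neg

/-- `u'' = uderiv2`. -/
theorem hasDerivAt_uderiv (r : ℝ) : HasDerivAt uderiv (uderiv2 r) r := by
  have h0 : (1 + Real.exp r) ≠ 0 := (one_add_exp_pos r).ne'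
  have h1 : HasDerivAt (fun r ↦ 1 + Real.exp r) (Real.exp r) r := by
    simpa using (Real.hasDerivAt_exp r).const_add 1
  have h2 := (Real.hasDerivAt_exp r).div h1 h0
  have h3 : HasDerivAt (fun x ↦ -(Real.exp x / (1 + Real.exp x)))
      (-((Real.exp r * (1 + Real.exp r) - Real.exp r * Real.exp r) / (1 + Real.exp r) ^ 2)) r :=
    h2.neg
  have h4 : HasDerivAt uderiv
      (-((Real.exp r * (1 + Real.exp r) - Real.exp r * Real.exp r) / (1 + Real.exp r) ^ 2)) r := h3
  refine h4.congr_deriv ?_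
  unfold uderiv2
  field_simp
  ring

/-- `u' < 0`. -/
theorem uderiv_lt_zero (r : ℝ) : uderiv r < 0 := by
  unfold uderiv
  have := div_pos (Real.exp_pos r) (one_add_exp_pos r)
  linarith

/-- `−1 < u'`. -/
theorem neg_one_lt_uderiv (r : ℝ) : -1 < uderiv r := by
  unfold uderiv
  have h : Real.exp r / (1 + Real.exp r) < 1 := by
    rw [div_lt_one (one_add_exp_pos r)]
    linarith
  linarith

/-- `|u'| < 1` (the graph is spacelike). -/
theorem abs_uderiv_lt_one (r : ℝ) : |uderiv r| < 1 :=
  abs_lt.mpr ⟨neg_one_lt_uderiv r, (uderiv_lt_zero r).trans one_pos⟩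

/-- `u'² < 1`. -/
theorem uderiv_sq_lt_one (r : ℝ) : uderiv r ^ 2 < 1 := by
  have := abs_uderiv_lt_one r
  have h2 : uderiv r ^ 2 = |uderiv r| ^ 2 := (sq_abs _).symm
  rw [h2]
  nlinarith [abs_nonneg (uderiv r)]

/-- `1 − u'² > 0`. -/
theorem one_sub_uderiv_sq_pos (r : ℝ) : 0 < 1 - uderiv r ^ 2 := by
  linarith [uderiv_sq_lt_one r]

/-- `u'' < 0` (the profile is concave: the graph contracts). -/
theorem uderiv2_lt_zero (r : ℝ) : uderiv2 r < 0 := by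
  unfold uderiv2
  have := div_pos (Real.exp_pos r) (pow_pos (one_add_exp_pos r) 2)
  linarith

/-- `u` is differentiable. -/
theorem differentiable_uprof : Differentiable ℝ uprof := fun r ↦ (hasDerivAt_uprof r).differentiableAt
/-- `u'` is differentiable. -/
theorem differentiable_uderiv : Differentiable ℝ uderiv := fun r ↦ (hasDerivAt_uderiv r).differentiableAt

/-- `u` is smooth (any order). -/
theorem contDiff_uprof {m : ℕ∞ω} : ContDiff ℝ m uprof := by
  unfold uprof
  have h1 : ContDiff ℝ m (fun r : ℝ ↦ 1 + Real.exp r) := contDiff_const.add Real.contDiff_exp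
  exact (h1.log fun r ↦ (one_add_exp_pos r).ne').neg

/-- `u'` is smooth (any order). -/
theorem contDiff_uderiv {m : ℕ∞ω} : ContDiff ℝ m uderiv := by
  unfold uderiv
  have h1 : ContDiff ℝ m (fun r : ℝ ↦ 1 + Real.exp r) := contDiff_const.add Real.contDiff_exp
  exact (Real.contDiff_exp.div h1 fun r ↦ (one_add_exp_pos r).ne').neg

/-- Strict `1`-Lipschitz: `|u(a) − u(b)| < |a − b|` for `a ≠ b` (mean value theorem, `|u'| < 1`). -/
theorem abs_uprof_sub_lt {a b : ℝ} (hab : a ≠ b) : |uprof a - uprof b| < |a - b| := by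
  wlog h : b < a generalizing a b
  · have h' : a < b := lt_of_le_of_ne (not_lt.mp h) hab
    have := this hab.symm h'
    rwa [abs_sub_comm, abs_sub_comm a b]
  obtain ⟨ξ, -, hξ⟩ := exists_hasDerivAt_eq_slope uprof uderiv h
    (differentiable_uprof.continuous.continuousOn) (fun x _ ↦ hasDerivAt_uprof x)
  have hpos : 0 < a - b := sub_pos.mpr h
  rw [abs_of_pos hpos]
  have : uprof a - uprof b = uderiv ξ * (a - b) := by
    rw [hξ]; field_simp
  rw [this, abs_mul, abs_of_pos hpos]
  calc |uderiv ξ| * (a - b) < 1 * (a - b) := mul_lt_mul_of_pos_right (abs_uderiv_lt_one ξ) hpos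
    _ = a - b := one_mul _

/-- The normalisation factor `c(r) = (1 − u'(r)²)^{−1/2} > 0`. -/
def cfac (r : ℝ) : ℝ := (Real.sqrt (1 - uderiv r ^ 2))⁻¹

/-- `c > 0`. -/
theorem cfac_pos (r : ℝ) : 0 < cfac r :=
  inv_pos.mpr (Real.sqrt_pos.mpr (one_sub_uderiv_sq_pos r))

/-- `c² (1 − u'²) = 1`. -/
theorem cfac_sq_mul (r : ℝ) : cfac r ^ 2 * (1 - uderiv r ^ 2) = 1 := by
  unfold cfac
  rw [inv_pow, Real.sq_sqrt (one_sub_uderiv_sq_pos r).le, inv_mul_cancel₀ (one_sub_uderiv_sq_pos r).ne']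

/-- `c` is differentiable (its derivative is never needed explicitly). -/
theorem differentiable_cfac : Differentiable ℝ cfac := by
  unfold cfac
  refine Differentiable.inv ?_ fun r ↦ (Real.sqrt_pos.mpr (one_sub_uderiv_sq_pos r)).ne'
  exact ((differentiable_const (1 : ℝ)).sub (differentiable_uderiv.pow 2)).sqrt
    fun r ↦ (one_sub_uderiv_sq_pos r).ne'


end Summit.FinalStateConjecture.FinalStateConjecture.Theorems.TameCensorship.Negative

end
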